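import Literature.Geometry.Riemannian.RicciFlowHConcentration
import Literature.Geometry.Riemannian.BamlerDistanceDistortionProofs
import HarnessLib

/-!
# The metric flow of a compact Ricci flow is `H_n`-concentrated — unconditionally
# (Bamler 2023, §3.7; Bamler 2020a, Thm. 3.5 and Cor. 3.7)

R. Bamler, *Compactness theory of the space of super Ricci flows*, Invent. Math. 233 (2023), §3.7,
Theorem: the metric flow of an `n`-dimensional (super) Ricci flow on a compact manifold is
`H_n`-concentrated, `H_n = (n − 1)π²/2 + 4`. `RicciFlowHConcentration.lean` records this
CONDITIONALLY on the named fact `bamler_distSq_heatOperator_barrier` (Bamler 2020a, Thm. 3.5 in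
the barrier sense); that fact is now proved (`bamler_distSq_heatOperator_barrier_holds`,
`BamlerDistanceDistortionProofs.lean`), and this file feeds the proof in:

* `ricciFlowMetricFlow_isHConcentrated` — `(ricciFlowMetricFlow hh hR hS hflow).IsHConcentrated H_m`
  for every `C^∞` Ricci flow of Riemannian metrics on a closed connected manifold of dimension
  `m ≥ 1` (any boundaryless model with corners on `ℝᵐ`), on an order-connected time set;
* `IsRicciFlow.metricFlow_isHConcentrated` — the same for `IsRicciFlow.metricFlow` (a flow given on
  `M × [0, T]`).

Everything is proved; no definitions, no named facts.

## References

* R. H. Bamler, *Compactness theory of the space of super Ricci flows*, Invent. Math. 233 (2023),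
  §3.4, §3.7. [Bamler2023]
* R. H. Bamler, *Entropy and heat kernel bounds on a Ricci flow background*, arXiv:2008.07093
  (2020), §3.1 Thm. 3.5, Cor. 3.7. [Bamler2020Entropy]
-/

noncomputable section

open Bundle Set Function Filter Manifold MeasureTheory Measure TopologicalSpace
open scoped Manifold ContDiff Topology ENNReal NNReal

namespace Literature.Geometry.Riemannian

open Lorentzian Lorentzian.PseudoRiemannianMetric

universe u v

section Concentration

variable {m : ℕ} {H : Type v} [TopologicalSpace H]
  {I : ModelWithCorners ℝ (EuclideanSpace ℝ (Fin m)) H} [I.Boundaryless]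
  {M : Type u} [TopologicalSpace M] [ChartedSpace H M] [IsManifold I ∞ M]
  [T2Space M] [CompactSpace M] [SecondCountableTopology M] [MeasurableSpace M] [BorelSpace M]
  [ConnectedSpace M]
  {h : ℝ → PseudoRiemannianMetric I ∞ (EuclideanSpace ℝ (Fin m)) (TangentSpace I : M → Type _)}
  {cov : ℝ → CovariantDerivative I (EuclideanSpace ℝ (Fin m)) (TangentSpace I : M → Type _)}

/-- **The metric flow of a compact Ricci flow is `H_m`-concentrated** (Bamler 2023, §3.7, via
Bamler 2020a, Thm. 3.5 and Cor. 3.7): for a `C^∞` family `h` of Riemannian metrics on a closed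
connected `m`-manifold, `m ≥ 1`, which is a Ricci flow on the order-connected time set `S`, the
metric flow `ricciFlowMetricFlow hh hR hS hflow` is `H_m`-concentrated,
`H_m = (m − 1)π²/2 + 4`. [cite: Bamler2023, §3.7] [cite: Bamler2020Entropy, §3.1, Cor. 3.7] -/
theorem ricciFlowMetricFlow_isHConcentrated (hm : 0 < m) (hh : IsContMDiffFamilyOn ∞ h univ)
    (hR : ∀ r, (h r).IsRiemannian) {S : Set ℝ} (hS : S.OrdConnected) (hflow : IsRicciFlow h cov S) :
    (ricciFlowMetricFlow hh hR hS hflow).IsHConcentrated (MetricFlow.concentrationConst m) :=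
  isHConcentrated_ricciFlowMetricFlow bamler_distSq_heatOperator_barrier_holds hm hh hR hS hflow

/-- **The metric flow over `[0, T]` of a Ricci flow given on `M × [0, T]` is `H_m`-concentrated**
(Bamler 2023, §3.7), unconditionally. [cite: Bamler2023, §3.7] -/
theorem IsRicciFlow.metricFlow_isHConcentrated (hm : 0 < m)
    {g : ℝ → PseudoRiemannianMetric I ∞ (EuclideanSpace ℝ (Fin m)) (TangentSpace I : M → Type _)}
    {T : ℝ} (hT : 0 < T) (hflow : IsRicciFlow g cov (Icc 0 T)) (hR : ∀ s ∈ Icc 0 T, (g s).IsRiemannian) :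
    (hflow.metricFlow hT hR).IsHConcentrated (MetricFlow.concentrationConst m) :=
  hflow.isHConcentrated_metricFlow bamler_distSq_heatOperator_barrier_holds hm hT hR

end Concentration

end Literature.Geometry.Riemannian

end
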